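import Summits.ABC.ABC.Theses.IsogenyGlueCongruence
import Summits.ABC.ABC.Theorems.IsogenyGlueCongruenceSemistableHeightPolyBound
import Summits.ABC.ABC.Theorems.IsogenyGlueCongruenceTorsionSharingLine
import Summits.ABC.ABC.Theorems.IsogenyGlueCongruenceTorsionSharingPrimeBoundStubSameLevel
import Summits.ABC.ABC.Theorems.IsogenyGlueCongruenceTorsionSharingPrimeBoundStubLevelLower
import Summits.ABC.ABC.Theorems.IsogenyGlueCongruenceTorsionSharingPrimeBoundStubLevelRaise
import Summits.ABC.ABC.Theorems.IsogenyGlueCongruenceTorsionSharingPrimeBoundJDenominator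

/-!
# Line skeleton v3 — crux `TorsionSharingPrimeBound` (K, stmt-ABC-2157), line `SketchIdeator3g2`
# (idea `absolute-size-collapse`), lead prover-line-stmt-ABC-2157-0

In tree (accepted): `IsogenyGlueCongruenceTorsionSharingLine.lean` (p87566: defs + proved glue
`polyDegreeOfAbsoluteSize`, `degreePrimesPolyBounded_of_poly`, `k_of_pieces`), the three worker
stubs `stub_sameLevel` (p89263), `stub_levelLower` (p89904), `stub_levelRaise` (p90299), and
conjunct (d) of `LevelMismatchFacts`, `absNorm_jDenominatorIdeal_eq_minimalDiscriminantNorm` (p90771).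

Composition (`sorry` only inside the six remaining `stub_*`; v3 reshapes the level-mismatch
fact-stub into its three Galois-theoretic conjuncts, the fourth being proved):

  C⁺ = `AbsoluteGluingExponentBound` (stub_absoluteSize, the bet — OPEN, crux-sized)
    + `ModularJacobianRankOne` (stub_jacobianRankOne — needs J₀(N) as an abelian variety over ℚ)
    + `SemistableHeightPolyBound` (route item 13918, hypothesis; in tree from Pasten Thm 1.9, p78763)
  ⟹ `PolyModularDegree` ⟹ crux A
  ⟹ (stub_sameLevel, LANDED, over the fact-stub `SameLevelCongruenceFacts`) `KSameLevel`
  + (stub_levelLower, stub_levelRaise, LANDED, over `LevelMismatchFacts` =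
     stub_unramifiedFact ∧ stub_steinbergFact ∧ stub_conductorDropFact ∧ (d) PROVED)
  ⟹ K (`k_of_pieces`, LANDED).
-/

noncomputable section

set_option linter.dupNamespace false

open Literature.NumberTheory.EllipticCurves.ModularForms
open Summit.ABC.ABC.Theses.IsogenyGlueCongruence
open scoped MatrixGroups ModularForm
open CongruenceSubgroup

namespace Summit.ABC.ABC.Theorems.IGCTorsionSharing

/-! ## Remaining stubs -/

/-- STUB (the bet, crux-sized, OPEN): C⁺ — the least positive `E`-multiplier of a geometrically
rank-one pair `E ⊂ B` is `≤ C (dim B · max(1, h_F(E)))^κ` with absolute `κ, C`. Its `J₀(N)`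
instance is the polynomial modular-degree conjecture (PastenShimura2024 Conj. 3.2, semistable). -/
theorem stub_absoluteSize : AbsoluteGluingExponentBound := by
  sorry

/-- STUB (fact-shaped instance; needs `J₀(N)` as an `AbelianVariety ℚ` with its `E`-multipliers
`= m_E ℤ` and `Hom_{ℚ̄}(E, J₀(N)) = ℤ φ^∨`; same blocker as route item stmt-ABC-13920). -/
theorem stub_jacobianRankOne : ModularJacobianRankOne := by
  sorry

/-- FACT-STUB (Literature debt): the printed same-level inputs (Ribet 1990 lowering + re-raising,
ARS 2012 §2.1 positivity, minimal degree divides (needs the Eichler–Shimura optimal datum), ARS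
Thm 2.1 = the tree's named fact `padicValNat_congruenceNumber_eq_of_not_sq_dvd`). -/
theorem stub_sameLevelFacts : SameLevelCongruenceFacts := by
  sorry

/-- FACT-STUB (Literature debt; Deligne unramifiedness of `ρ̄_g` at `p ∤ Mℓ`, Mazur irreducibility
for `ℓ ≥ 11`, Brauer–Nesbitt, Tate curve / Serre 1987 §4.1): a level-lowering prime `p ∣ N`, `p ∤ M`
of a congruence `f_W ≡ g (mod λ ∣ ℓ)` has `ℓ ∣ v_p(Δ_min)`. -/
theorem stub_unramifiedFact :
    ∀ (W : WeierstrassCurve ℚ) [W.IsElliptic] [W.IsGloballyMinimal] [NeZero (W.conductorNorm ℤ)],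
    W.IsSemistable ℤ → ∀ (M : ℕ) [NeZero M] (g : CuspForm (Gamma0 M) 2), IsNewform0 g →
    ∀ ℓ : ℕ, ℓ.Prime → 11 ≤ ℓ → ¬ (ℓ ∣ M * W.conductorNorm ℤ) → CongruentAway W M g ℓ →
    ∀ v : IsDedekindDomain.HeightOneSpectrum ℤ,
      Rat.HeightOneSpectrum.natGenerator v ∣ W.conductorNorm ℤ →
      ¬ (Rat.HeightOneSpectrum.natGenerator v ∣ M) → ℓ ∣ W.ordMinimalDiscriminant v := by
  sorry

/-- FACT-STUB (Literature debt; Carayol 1986 local–global compatibility at `q ∥ M`, necessity half of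
Ribet's level-raising theorem, Diamond–Taylor 1994 Thm A): at a prime `q ∥ M`, `q ∤ N`,
`a_q(W) ≡ ±(q+1) (mod ℓ)`. -/
theorem stub_steinbergFact :
    ∀ (W : WeierstrassCurve ℚ) [W.IsElliptic] [W.IsGloballyMinimal] [NeZero (W.conductorNorm ℤ)],
    W.IsSemistable ℤ → ∀ (M : ℕ) [NeZero M] (g : CuspForm (Gamma0 M) 2), IsNewform0 g →
    ∀ ℓ : ℕ, ℓ.Prime → 11 ≤ ℓ → ¬ (ℓ ∣ M * W.conductorNorm ℤ) → CongruentAway W M g ℓ →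
    ∀ q : ℕ, q.Prime → q ∣ M → ¬ (q ^ 2 ∣ M) → ¬ (q ∣ W.conductorNorm ℤ) →
      (ℓ : ℤ) ∣ ((q : ℤ) + 1) ^ 2 - (W.LFunction q) ^ 2 := by
  sorry

/-- FACT-STUB (Literature debt; Carayol 1989 Thm 2 / Livné 1989 on the drop of the conductor
exponent modulo `ℓ`, Diamond–Taylor 1994 Thm A): a congruence partner of level divisible by `q²`
forces `ℓ ∣ q² − 1`. -/
theorem stub_conductorDropFact :
    ∀ (W : WeierstrassCurve ℚ) [W.IsElliptic] [W.IsGloballyMinimal] [NeZero (W.conductorNorm ℤ)],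
    W.IsSemistable ℤ → ∀ (M : ℕ) [NeZero M] (g : CuspForm (Gamma0 M) 2), IsNewform0 g →
    ∀ ℓ : ℕ, ℓ.Prime → 11 ≤ ℓ → ¬ (ℓ ∣ M * W.conductorNorm ℤ) → CongruentAway W M g ℓ →
    ∀ q : ℕ, q.Prime → q ^ 2 ∣ M → (ℓ : ℤ) ∣ (q : ℤ) ^ 2 - 1 := by
  sorry

/-! ## Glue (proved) -/

/-- The level-mismatch bundle from its three Galois-theoretic conjuncts and the PROVED Silverman
conjunct (d) (`absNorm_jDenominatorIdeal_eq_minimalDiscriminantNorm`, p90771). -/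
theorem levelMismatchFacts_of_stubs : LevelMismatchFacts :=
  ⟨stub_unramifiedFact, stub_steinbergFact, stub_conductorDropFact,
    fun W _ _ hW => absNorm_jDenominatorIdeal_eq_minimalDiscriminantNorm W hW⟩

/-! ## The crux from the stubs -/

/-- **K from the line**, conditional on the route's support item `SemistableHeightPolyBound`
(stmt-ABC-13918; in tree from Pasten's Thm 1.9 as
`semistableHeightPolyBound_of_pasten2024_height_lt`, p78763). -/
theorem TorsionSharingPrimeBound_of (hH : SemistableHeightPolyBound) : TorsionSharingPrimeBound :=
  k_of_pieces
    (stub_sameLevel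
      (degreePrimesPolyBounded_of_poly
        (polyDegreeOfAbsoluteSize stub_absoluteSize stub_jacobianRankOne hH))
      stub_sameLevelFacts)
    (stub_levelLower hH levelMismatchFacts_of_stubs) (stub_levelRaise levelMismatchFacts_of_stubs)

/-- The same over the named Literature fact `pasten2024_height_lt` (PastenShimura2024 Thm 1.9). -/
theorem torsionSharingPrimeBound_of_pasten (hP : pasten2024_height_lt) : KCrux :=
  TorsionSharingPrimeBound_of (semistableHeightPolyBound_of_pasten2024_height_lt hP)

end Summit.ABC.ABC.Theorems.IGCTorsionSharing

end
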